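import Literature.NumberTheory.EllipticCurves.CasselsTateCanonicalAdjoint
import HarnessLib

/-!
# ★ The definition-level restriction/corestriction package of the Cassels–Tate pairing of the canonical
# invariant maps (sequel of `CasselsTateCanonicalAdjoint`; theorems only)

Topic `NumberTheory/EllipticCurves`; namespace `Literature.NumberTheory.EllipticCurves`. Theorems only:
**no definition, no named fact** (D-0026); the one displayed input is the named fact
`casselsTate_canonical_adjoint K σ₀ h2 hσ₀` of `CasselsTateCanonicalAdjoint.lean` (Milne *ADT* I
Rem. 6.10(a) + Fisher 2003 Prop. 2.16 for Milne's recipe on THE canonical family).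

`exists_ctLevelPairing_resCor_package` is the DEFINITION-LEVEL twin of
`exists_casselsTate_resCor_package` (`CasselsTateResCorAdjoint.lean`, which consumes the anonymous
∃-fact `casselsTate_pairing_resCor`): for `E = W/ℚ` with `E_K` elliptic, ONE level `m = 2^k` killing the
two `2`-primary parts, COMPATIBLE Weil-type pairings `eℚ`, `eK`, Milne's inputs for the two canonical
families, the LEVEL property of the two recipes, the (WRAP-𝒪) data `(φ, w)` and the (WRAP-σ) data
`(τ, s)` of the cell's LEMMA-D packages, and injectivity of `resBaseChange W K`, it returns pairings
`Bℚ₂` on `Ш(E/ℚ)[2^∞]` and `B₂` on `Ш(E_K/K)[2^∞]` PINNED to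
`zmodToCircle (m²) ∘ ctGeneralFun … (LocalInvariants.canonical _ (m²))` (`CasselsTateLevelPrimary`),
alternating, antisymmetric, with trivial kernels, `B₂` `𝒪`-balanced (`omegaBalanced_of_canonical_adjoint`),
and the restriction `res₂` with `B₂ (res₂ a) (res₂ b) = 2 • Bℚ₂ a b`, `B₂ (res₂ a) (w (res₂ b)) = -(Bℚ₂ a b)`
(clause (vii) with `cor ∘ res = 2`, `res ∘ cor = 1 + τ_*` of `ShaCorestrictionIndexTwo.lean`) — the
(CT-3′) hypotheses `hrr`/`hrw` of `Summits/…/SylvesterTwoHeegnerIndexCoupledTelescopeLagrangian` for the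
SAME pairing whose Selmer pull-back carries McCallum's value formula.  Nothing curve-specific is proved;
BSD is not advanced.

## References

* [Fisher2003] T. A. Fisher, *The Cassels–Tate pairing and the Platonic solids*, J. Number Theory 98
  (2003), Prop. 2.16 (p. 132).
* [MilneADT2006] J. S. Milne, *Arithmetic Duality Theorems*, 2nd ed. (2006), Ch. I §6 Prop. 6.9,
  Rem. 6.10(a), Thm. 6.13(a).
* [SerreGaloisCohomology1997] J.-P. Serre, *Galois Cohomology*, I.§2.4 Prop. 9.
-/

noncomputable section

open scoped Classical AddSubgroup

namespace Literature.NumberTheory.EllipticCurves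

open Literature.GroupTheory.FiniteAbelian

/-! ## §4. ★ The definition-level res/cor package from clause (vii) -/

section Package

open _root_.WeierstrassCurve Field NumberField Function
open Literature.NumberTheory.GaloisRepresentations Literature.NumberTheory.GaloisCohomology
open Literature.NumberTheory.GaloisRepresentations.DiscreteGaloisModule (mu MuCarrier)
open Literature.GroupTheory.FiniteAbelian

variable {K : Type} [Field K] [NumberField K] {σ₀ : K ≃ₐ[ℚ] K} {h2 : Module.finrank ℚ K = 2}
  {hσ₀ : σ₀ ≠ 1}

set_option maxHeartbeats 400000 in
/-- **★ The DEFINITION-LEVEL res/cor package (twin of `exists_casselsTate_resCor_package`, p697672, with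
the pairings PINNED to Milne's recipe of the canonical families).**  For `E = W/ℚ` with `E_K` elliptic,
ONE level `m = 2^k` killing `Ш(E/ℚ)[2^∞]` and `Ш(E_K/K)[2^∞]` (`hkℚ`, `hkK`), Weil-type pairings `eℚ`,
`eK` on `E[m²]` COMPATIBLE along the base change (`hee`), Milne's inputs for the two canonical families
(`hPT'`, `hH3`, `hfin`: proof binders) and the LEVEL property of the two recipes (`hLPℚ`, `hLPK`:
`isLevelPairing_ctLevelPairing_of_inputs`), the (WRAP-𝒪) data `(φ, w, hw, hwrel)` on `Ш(E_K/K)[2^∞]`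
(`H¹`-level `hw`), the (WRAP-σ) data `(s, hs, hsw)` for a lift `τ` of `σ₀`, and injectivity of
`resBaseChange W K`: there are `Bℚ₂` on `Ш(E/ℚ)[2^∞]`, `B₂` on `Ш(E_K/K)[2^∞]` and `res₂` over
`shaRestriction W K` such that `Bℚ₂ a b = zmodToCircle (m²) (ctGeneralFun W m eℚ … (canonical ℚ) a b)`,
`B₂ a b = zmodToCircle (m²) (ctGeneralFun E_K m eK … (canonical K) a b)` (PINNED), both alternating,
antisymmetric with trivial kernels, `B₂` `𝒪`-BALANCED (both spellings), and
`B₂ (res₂ a) (res₂ b) = 2 • Bℚ₂ a b`, `B₂ (res₂ a) (w (res₂ b)) = -(Bℚ₂ a b)` — from clause (vii) with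
`cor ∘ res = 2` (`corBaseChange_resBaseChange`) and `res ∘ cor = 1 + τ_*` (`resBaseChange_corBaseChange`).
These are EXACTLY the (CT-3′) hypotheses of `Summits/…/SylvesterTwoHeegnerIndexCoupledTelescopeLagrangian`
(`r := res₂`, `B₀ := Bℚ₂`, `B := B₂`) for the SAME pairing that carries the value theorems.
[cite: Fisher2003, Prop. 2.16 (JNT 98, p. 132)] [cite: MilneADT2006, Ch. I §6 Prop. 6.9, Rem. 6.10(a), Thm. 6.13(a)]
[cite: SerreGaloisCohomology1997, I.§2.4 Prop. 9] -/
theorem exists_ctLevelPairing_resCor_package (hF : casselsTate_canonical_adjoint K σ₀ h2 hσ₀)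
    (W : WeierstrassCurve ℚ) [W.IsElliptic] [(W.baseChange K).IsElliptic] (m : ℕ) [NeZero m] {k : ℕ}
    (hm : m = 2 ^ k)
    (eℚ : geomTorsion W ((m * m : ℕ) : ℤ) → geomTorsion W ((m * m : ℕ) : ℤ) → AlgebraicClosure ℚ)
    (hμ : ∀ S T, eℚ S T ^ (m * m) = 1)
    (hadd₁ : ∀ S₁ S₂ T, eℚ (S₁ + S₂) T = eℚ S₁ T * eℚ S₂ T)
    (hadd₂ : ∀ S T₁ T₂, eℚ S (T₁ + T₂) = eℚ S T₁ * eℚ S T₂)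
    (hgal : ∀ (σ : absoluteGaloisGroup ℚ) (S T : geomTorsion W ((m * m : ℕ) : ℤ)),
      σ • eℚ S T = eℚ (σ • S) (σ • T))
    (halt : ∀ T, eℚ T T = 1) (hnd : ∀ T, (∀ S, eℚ S T = 1) → T = 0)
    (eK : geomTorsion (W.baseChange K) ((m * m : ℕ) : ℤ) →
      geomTorsion (W.baseChange K) ((m * m : ℕ) : ℤ) → AlgebraicClosure K)
    (hμK : ∀ S T, eK S T ^ (m * m) = 1)
    (hadd₁K : ∀ S₁ S₂ T, eK (S₁ + S₂) T = eK S₁ T * eK S₂ T)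
    (hadd₂K : ∀ S T₁ T₂, eK S (T₁ + T₂) = eK S T₁ * eK S T₂)
    (hgalK : ∀ (σ : absoluteGaloisGroup K) (S T : geomTorsion (W.baseChange K) ((m * m : ℕ) : ℤ)),
      σ • eK S T = eK (σ • S) (σ • T))
    (haltK : ∀ T, eK T T = 1) (hndK : ∀ T, (∀ S, eK S T = 1) → T = 0)
    (hee : ∀ (S T : geomTorsion W ((m * m : ℕ) : ℤ))
      (S' T' : geomTorsion (W.baseChange K) ((m * m : ℕ) : ℤ)),
      (S' : geomPoints (W.baseChange K)) = geomPointsEquivBaseChange K W S →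
      (T' : geomPoints (W.baseChange K)) = geomPointsEquivBaseChange K W T →
      (eK S' T' : AlgebraicClosure K) = closureEmb (K := ℚ) K (eℚ S T))
    (hPT'ℚ : (LocalInvariants.canonical ℚ (m * m)).SumInvLocalizationEqZero)
    (hH3ℚ : ∀ c : galoisCohomology (mu ℚ (m * m)) 3,
      (∀ v : Place ℚ, galoisCohomology.localization (mu ℚ (m * m)) v 3 c = 0) → c = 0)
    (hfinℚ : ∀ D : GeneralCaseData W m eℚ hμ hadd₁ hadd₂ hgal, ∃ S : Finset (Place ℚ),
      ∀ v ∉ S, D.localTerm (LocalInvariants.canonical ℚ (m * m)) v = 0)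
    (hPT'K : (LocalInvariants.canonical K (m * m)).SumInvLocalizationEqZero)
    (hH3K : ∀ c : galoisCohomology (mu K (m * m)) 3,
      (∀ v : Place K, galoisCohomology.localization (mu K (m * m)) v 3 c = 0) → c = 0)
    (hfinK : ∀ D : GeneralCaseData (W.baseChange K) m eK hμK hadd₁K hadd₂K hgalK, ∃ S : Finset (Place K),
      ∀ v ∉ S, D.localTerm (LocalInvariants.canonical K (m * m)) v = 0)
    (hLPℚ : IsLevelPairing m (ctLevelPairing W m eℚ hμ hadd₁ hadd₂ hgal
      (LocalInvariants.canonical ℚ (m * m)) halt hPT'ℚ hH3ℚ hfinℚ))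
    (hLPK : IsLevelPairing m (ctLevelPairing (W.baseChange K) m eK hμK hadd₁K hadd₂K hgalK
      (LocalInvariants.canonical K (m * m)) haltK hPT'K hH3K hfinK))
    (hkℚ : ∀ x ∈ AddCommGroup.primaryComponent W.sha 2, 2 ^ k • x = 0)
    (hkK : ∀ x ∈ AddCommGroup.primaryComponent (W.baseChange K).sha 2, 2 ^ k • x = 0)
    (φ : Isogeny (W.baseChange K) (W.baseChange K))
    (w : AddCommGroup.primaryComponent (W.baseChange K).sha 2 →+
      AddCommGroup.primaryComponent (W.baseChange K).sha 2)
    (hw : ∀ x, (((w x : AddCommGroup.primaryComponent (W.baseChange K).sha 2) :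
        (W.baseChange K).sha) : (W.baseChange K).galH1) =
      galH1Map φ.toAddMonoidHom φ.equivariant ((x : (W.baseChange K).sha) : (W.baseChange K).galH1))
    (hwrel : ∀ x, w (w x) + w x + x = 0)
    {τ : AlgebraicClosure K ≃+* AlgebraicClosure K} (hτ : IsLiftOfAut σ₀ τ)
    (s : AddCommGroup.primaryComponent (W.baseChange K).sha 2 →+
      AddCommGroup.primaryComponent (W.baseChange K).sha 2)
    (hs : ∀ x, (((s x : AddCommGroup.primaryComponent (W.baseChange K).sha 2) :
        (W.baseChange K).sha) : (W.baseChange K).galH1) =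
      hτ.conjH1Points W ((x : (W.baseChange K).sha) : (W.baseChange K).galH1))
    (hsw : ∀ x, s (w x) = -(s x) - w (s x))
    (hinj : Function.Injective (resBaseChange W K)) :
    ∃ (Bℚ₂ : AddCommGroup.primaryComponent W.sha 2 →+ AddCommGroup.primaryComponent W.sha 2 →+
        AddCircle (1 : ℚ))
      (B₂ : AddCommGroup.primaryComponent (W.baseChange K).sha 2 →+
        AddCommGroup.primaryComponent (W.baseChange K).sha 2 →+ AddCircle (1 : ℚ))
      (res₂ : AddCommGroup.primaryComponent W.sha 2 →+
        AddCommGroup.primaryComponent (W.baseChange K).sha 2),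
      (∀ a b, Bℚ₂ a b = zmodToCircle (m * m) (ctGeneralFun W m eℚ hμ hadd₁ hadd₂ hgal
        (LocalInvariants.canonical ℚ (m * m)) ((a : W.sha) : W.galH1) ((b : W.sha) : W.galH1))) ∧
      (∀ a b, B₂ a b = zmodToCircle (m * m) (ctGeneralFun (W.baseChange K) m eK hμK hadd₁K hadd₂K hgalK
        (LocalInvariants.canonical K (m * m)) ((a : (W.baseChange K).sha) : (W.baseChange K).galH1)
        ((b : (W.baseChange K).sha) : (W.baseChange K).galH1))) ∧
      (∀ a, ((res₂ a : AddCommGroup.primaryComponent (W.baseChange K).sha 2) :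
        (W.baseChange K).sha) = shaRestriction W K a) ∧
      ((∀ a, Bℚ₂ a a = 0) ∧ (∀ a b, Bℚ₂ b a = -(Bℚ₂ a b)) ∧
        (∀ a, (∀ b, Bℚ₂ a b = 0) → a = 0) ∧ (∀ b, (∀ a, Bℚ₂ a b = 0) → b = 0)) ∧
      ((∀ a, B₂ a a = 0) ∧ (∀ a b, B₂ b a = -(B₂ a b)) ∧
        (∀ a b, B₂ (w a) b = B₂ a (w (w b))) ∧ (∀ a b, B₂ (w a) b = B₂ a (-b - w b)) ∧
        (∀ a, (∀ b, B₂ a b = 0) → a = 0) ∧ (∀ b, (∀ a, B₂ a b = 0) → b = 0)) ∧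
      (∀ a b, B₂ (res₂ a) (res₂ b) = 2 • Bℚ₂ a b) ∧
      (∀ a b, B₂ (res₂ a) (w (res₂ b)) = -(Bℚ₂ a b)) := by
  obtain ⟨hleℚ, Bℚ₂, -, hBℚ₂, hℚalt, hℚanti, hℚl, hℚr⟩ :=
    exists_primaryComponent_ctLevelPairing W m eℚ hμ hadd₁ hadd₂ hgal (LocalInvariants.canonical ℚ (m * m))
      halt hPT'ℚ hH3ℚ hfinℚ Nat.prime_two hm hLPℚ hkℚ
  obtain ⟨hleK, B₂, -, hBK₂, hKalt, hKanti, hKl, hKr⟩ :=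
    exists_primaryComponent_ctLevelPairing (W.baseChange K) m eK hμK hadd₁K hadd₂K hgalK
      (LocalInvariants.canonical K (m * m)) haltK hPT'K hH3K hfinK Nat.prime_two hm hLPK hkK
  -- the restriction on the 2-primary parts
  have hresmem : ∀ a : AddCommGroup.primaryComponent W.sha 2,
      shaRestriction W K a ∈ AddCommGroup.primaryComponent (W.baseChange K).sha 2 := fun a ↦ by
    obtain ⟨j, hj⟩ := (AddCommGroup.mem_primaryComponent (G := W.sha)).mp a.2
    have h := congrArg (shaRestriction W K) hj
    rw [map_nsmul, map_zero] at h
    exact (AddCommGroup.mem_primaryComponent (G := (W.baseChange K).sha)).mpr ⟨j, h⟩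
  obtain ⟨res₂, hres₂⟩ : ∃ res₂ : AddCommGroup.primaryComponent W.sha 2 →+
      AddCommGroup.primaryComponent (W.baseChange K).sha 2,
      ∀ a, ((res₂ a : AddCommGroup.primaryComponent (W.baseChange K).sha 2) :
        (W.baseChange K).sha) = shaRestriction W K a :=
    ⟨((shaRestriction W K).comp (AddCommGroup.primaryComponent W.sha 2).subtype).codRestrict _
      fun a ↦ hresmem a, fun _ ↦ rfl⟩
  have hres₂' : ∀ a : AddCommGroup.primaryComponent W.sha 2,
      (((res₂ a : AddCommGroup.primaryComponent (W.baseChange K).sha 2) : (W.baseChange K).sha) :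
        (W.baseChange K).galH1) = resBaseChange W K ((a : W.sha) : W.galH1) := fun a ↦ by
    rw [hres₂, coe_shaRestriction_apply]
  -- torsion bookkeeping
  have htorℚ : ∀ x : AddCommGroup.primaryComponent W.sha 2,
      (m : ℤ) • (((x : AddCommGroup.primaryComponent W.sha 2) : W.sha) : W.galH1) = 0 := by
    intro x
    have h := congrArg (fun z : W.sha ↦ (z : W.galH1)) (hkℚ x.1 x.2)
    have h' : (2 ^ k : ℕ) • (((x : AddCommGroup.primaryComponent W.sha 2) : W.sha) : W.galH1) = 0 := by
      simpa only [AddSubgroupClass.coe_nsmul, ZeroMemClass.coe_zero] using h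
    rw [hm, natCast_zsmul]
    exact h'
  have htorK : ∀ x : AddCommGroup.primaryComponent (W.baseChange K).sha 2,
      (m : ℤ) • (((x : AddCommGroup.primaryComponent (W.baseChange K).sha 2) : (W.baseChange K).sha) :
        (W.baseChange K).galH1) = 0 := by
    intro x
    have h := congrArg (fun z : (W.baseChange K).sha ↦ (z : (W.baseChange K).galH1)) (hkK x.1 x.2)
    have h' : (2 ^ k : ℕ) • (((x : AddCommGroup.primaryComponent (W.baseChange K).sha 2) :
        (W.baseChange K).sha) : (W.baseChange K).galH1) = 0 := by
      simpa only [AddSubgroupClass.coe_nsmul, ZeroMemClass.coe_zero] using h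
    rw [hm, natCast_zsmul]
    exact h'
  -- Ш-level form of `hw` and the 𝒪-balance from clause (vi)
  have hw' : ∀ x, ((w x : AddCommGroup.primaryComponent (W.baseChange K).sha 2) :
      (W.baseChange K).sha) =
      shaMap φ.toAddMonoidHom φ.equivariant φ.hasLocalPointsMaps_toAddMonoidHom x := fun x ↦ by
    apply Subtype.ext
    rw [hw, coe_shaMap_apply]
  have hbal := fun a b ↦ omegaBalanced_of_canonical_adjoint (W.baseChange K) m eK hμK hadd₁K hadd₂K hgalK
    hF hm hkK B₂ hBK₂ φ w hw' hwrel haltK hndK a b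
  -- consequence 1: `B₂ (res a) (res b) = 2 • Bℚ₂ a b`
  have hc1 : ∀ a b : AddCommGroup.primaryComponent W.sha 2, B₂ (res₂ a) (res₂ b) = 2 • Bℚ₂ a b :=
    fun a b ↦ by
    have hcmem : corBaseChange K W σ₀ h2 hσ₀ (resBaseChange W K ((b : W.sha) : W.galH1)) ∈ W.sha := by
      rw [← coe_shaRestriction_apply]
      exact corBaseChange_shaRestriction_mem K W σ₀ h2 hσ₀ _
    have hcm : (m : ℤ) • resBaseChange W K ((b : W.sha) : W.galH1) = 0 := by
      rw [← map_zsmul, htorℚ b, map_zero]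
    rw [hBK₂, hres₂' a, hres₂' b,
      hF.2 W m eℚ hμ hadd₁ hadd₂ hgal eK hμK hadd₁K hadd₂K hgalK halt hnd haltK hndK hee _ _ (a : W.sha).2
        (by rw [← coe_shaRestriction_apply]; exact (shaRestriction W K _).2) (htorℚ a) hcm hcmem,
      corBaseChange_resBaseChange]
    rw [show (2 • ((b : W.sha) : W.galH1)) =
        (((2 • b : AddCommGroup.primaryComponent W.sha 2) : W.sha) : W.galH1) by
      simp only [AddSubgroupClass.coe_nsmul], ← hBℚ₂, map_nsmul]
  -- consequence 2: `c = w (res b)` satisfies `c + τ_* c = res (−b)`, so `cor c = −b`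
  have hc2 : ∀ a b : AddCommGroup.primaryComponent W.sha 2,
      B₂ (res₂ a) (w (res₂ b)) = -(Bℚ₂ a b) := fun a b ↦ by
    have hsres : s (res₂ b) = res₂ b := by
      apply Subtype.ext; apply Subtype.ext
      rw [hs, hres₂, conjH1Points_shaRestriction]
    have key : w (res₂ b) + s (w (res₂ b)) = -(res₂ b) := by rw [hsw, hsres]; abel
    have key' := congrArg (fun z : AddCommGroup.primaryComponent (W.baseChange K).sha 2 ↦
      ((z : (W.baseChange K).sha) : (W.baseChange K).galH1)) key
    simp only [AddMemClass.coe_add, NegMemClass.coe_neg] at key'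
    rw [hs (w (res₂ b)), hres₂' b, ← map_neg] at key'
    have hcor : corBaseChange K W σ₀ h2 hσ₀ (((w (res₂ b) : AddCommGroup.primaryComponent
        (W.baseChange K).sha 2) : (W.baseChange K).sha) : (W.baseChange K).galH1) =
        -((b : W.sha) : W.galH1) :=
      hinj (by rw [resBaseChange_corBaseChange K W σ₀ h2 hσ₀ hτ, key'])
    have hcmem : corBaseChange K W σ₀ h2 hσ₀ (((w (res₂ b) : AddCommGroup.primaryComponent
        (W.baseChange K).sha 2) : (W.baseChange K).sha) : (W.baseChange K).galH1) ∈ W.sha := by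
      rw [hcor]; exact W.sha.neg_mem (b : W.sha).2
    rw [hBK₂, hres₂' a,
      hF.2 W m eℚ hμ hadd₁ hadd₂ hgal eK hμK hadd₁K hadd₂K hgalK halt hnd haltK hndK hee _ _ (a : W.sha).2
        ((w (res₂ b) : AddCommGroup.primaryComponent (W.baseChange K).sha 2) : (W.baseChange K).sha).2
        (htorℚ a) (htorK _) hcmem,
      hcor]
    rw [show (-((b : W.sha) : W.galH1)) =
        (((-b : AddCommGroup.primaryComponent W.sha 2) : W.sha) : W.galH1) by
      simp only [NegMemClass.coe_neg], ← hBℚ₂, map_neg]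
  exact ⟨Bℚ₂, B₂, res₂, hBℚ₂, hBK₂, hres₂, ⟨hℚalt, hℚanti, hℚl, hℚr⟩,
    ⟨hKalt, hKanti, fun a b ↦ (hbal a b).1, fun a b ↦ (hbal a b).2, hKl, hKr⟩, hc1, hc2⟩

end Package

end Literature.NumberTheory.EllipticCurves

end
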